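import Summits.RiemannHypothesis.RiemannHypothesis.Theorems.WeilFormatCDeflatedFarDoorSectorsB
import Summits.RiemannHypothesis.RiemannHypothesis.Theorems.WeilFormatCFarAssemblyA
import HarnessLib

/-!
# Format C, design C∞ ("DoorB"): `WeilPositivityOn a` from the deflated certificate with the free map folded into the coupling

Route context: Fourier–Galerkin / Schur-complement certificates of Weil positivity on a window ("format C";
cell memo `run/shared/lean/pub/rh-explicit/rh-explicit-weil-10/KERNEL-LEVER.md` §19–§20, sizing note
`run/shared/lean/pub/rh-explicit/rh-explicit-weil-2/gen9/CINF-DOOR-SIZING.md` §7; supporting stmt-RiemannHypothesis-0098;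
seat rh-explicit-weil-10).  The DoorB variants of the C∞ front door `weilPositivityOn_of_formatC_cinf` and of its
certified-prime-constant form `weilPositivityOn_of_formatC_cinfA`: per sector the data supply a far diagonal with floor (and
either its far inequality or `hPA` + `d̂_data ≤ d̂_A`), a free map `Λ` with its `ℓ¹` bound, a majorant `Uq` of the SHIFTED
limit coupling `Σ_{m∈[B,N)} (g_m − Σ_j V(m,j)Λ_j)²/d̂_m` for every `N` — one quadratic tail object, in the same
`m`-families as the images (`WeilFormatCDeflatedFarCouplingGram`, `WeilFormatCFamilyGram`) — and ONE kernel inequality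
`δ(Σx² + Σβ²) ≤ aug − Uq + 2Σ_j Λ_j(β_j − Σ_{j'} E∞(j,j')β_{j'})` with `E∞` in closed form by Parseval
(`WeilFormatCDeflatedFarParseval`).  No `A∞/ρ∞/σ∞` series.

* `weilPositivityOn_of_formatC_cinfB`, `weilPositivityOn_of_formatC_cinfBA`.

Standard axioms; no definitions; no RH claim beyond the stated case.
-/

set_option autoImplicit false
-- `Summit.RiemannHypothesis.RiemannHypothesis.…` is the layout-mandated namespace (summit = problem name).
set_option linter.dupNamespace false

noncomputable section

open Complex Filter Set MeasureTheory Finset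
open scoped Real Topology ComplexConjugate

namespace Summit.RiemannHypothesis.RiemannHypothesis.Theorems.WeilFormatC

open Literature.NumberTheory.LFunctions Literature.NumberTheory.LFunctions.Yoshida1992
open Literature.Analysis.SpecialFunctions

variable {a : ℝ}

/-- **Weil positivity on `[−a, a]` from a C∞ certificate in DoorB form** (see the module docstring). -/
theorem weilPositivityOn_of_formatC_cinfB (ha : 0 < a)
    -- EVEN sector
    (Be : ℕ) {re : ℕ} (fe : Fin re → ℝ → ℂ)
    (hfeC : ∀ j, ContDiff ℝ 3 (fe j)) (hfee : ∀ j x, fe j (-x) = fe j x) (hfer : ∀ j x, conj (fe j x) = fe j x)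
    (hfe1 : ∀ j, deriv (fe j) (-a) = deriv (fe j) a)
    -- DATA: far diagonal with floor and far inequality
    (de : ℕ → ℝ) {d₀e : ℝ} (hde₀ : 0 < d₀e) (hde : ∀ m, Be + 1 ≤ m → d₀e ≤ de m)
    (hfare : ∀ (N : ℕ) (y : ℕ → ℝ),
      ∑ n ∈ Finset.Ico (Be + 1) N, de n * y n ^ 2 ≤ ∑ n ∈ Finset.Ico (Be + 1) N, ∑ m ∈ Finset.Ico (Be + 1) N,
        y n * (if n = 0 then gramCoeff a 0 m else if m = 0 then gramCoeff a n 0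
          else (gramCoeff a n m + gramCoeff a n (-(m : ℤ))) / 2) * y m)
    -- DATA: free map, coupling majorant, margin
    (Λe : (Fin (Be + 1) → ℝ) → (Fin re → ℝ) → Fin re → ℝ) {lame : ℝ} (hlame : 0 ≤ lame)
    (hΛe : ∀ (x : Fin (Be + 1) → ℝ) (β : Fin re → ℝ), ∑ j, |Λe x β j| ≤ lame * (∑ i, |x i| + ∑ j, |β j|))
    (Uqe : (Fin (Be + 1) → ℝ) → (Fin re → ℝ) → ℝ)
    (hUqe : ∀ (N : ℕ) (x : Fin (Be + 1) → ℝ) (β : Fin re → ℝ),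
      ∑ m ∈ Finset.Ico (Be + 1) N,
        (∑ i : Fin (Be + 1), (if (i : ℕ) = 0 then gramCoeff a 0 m else if m = 0 then gramCoeff a i 0
            else (gramCoeff a i m + gramCoeff a i (-(m : ℤ))) / 2) * x i
          + ∑ j, ((weilWindowSesq a ((Icc (-a) a).indicator (fe j) - proj a Be ((Icc (-a) a).indicator (fe j)))
              (chiEven a m)).re / (if m = 0 then 1 else Real.sqrt 2)) * β j
          - ∑ j, ((if m = 0 then 1 else 2) * (Yoshida1992.fourierCoeff a m ((Icc (-a) a).indicator (fe j))).re /
              Real.sqrt (2 * a)) * Λe x β j) ^ 2 / de m ≤ Uqe x β)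
    {δe : ℝ} (hδe : 0 < δe)
    (hSe : ∀ (x : Fin (Be + 1) → ℝ) (β : Fin re → ℝ),
      δe * (∑ i, x i ^ 2 + ∑ j, β j ^ 2) ≤
        ((∑ i : Fin (Be + 1), ∑ i' : Fin (Be + 1), x i * x i' *
            (if (i : ℕ) = 0 then gramCoeff a 0 i' else if (i' : ℕ) = 0 then gramCoeff a i 0
              else (gramCoeff a i i' + gramCoeff a i (-(i' : ℤ))) / 2))
          + 2 * (∑ i : Fin (Be + 1), ∑ j : Fin re, x i * β j *
            ((weilWindowSesq a ((Icc (-a) a).indicator (fe j) - proj a Be ((Icc (-a) a).indicator (fe j)))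
              (chiEven a i)).re / (if (i : ℕ) = 0 then 1 else Real.sqrt 2)))
          + (∑ j : Fin re, ∑ j' : Fin re, β j * β j' *
            (weilWindowSesq a ((Icc (-a) a).indicator (fe j) - proj a Be ((Icc (-a) a).indicator (fe j)))
              ((Icc (-a) a).indicator (fe j') - proj a Be ((Icc (-a) a).indicator (fe j')))).re))
        - Uqe x β
        + 2 * ∑ j, Λe x β j * (β j - ∑ j', (∑' n : ℕ, if Be + 1 ≤ n then
                ((if n = 0 then 1 else 2) * (Yoshida1992.fourierCoeff a n ((Icc (-a) a).indicator (fe j))).re /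
                  Real.sqrt (2 * a)) *
                ((if n = 0 then 1 else 2) * (Yoshida1992.fourierCoeff a n ((Icc (-a) a).indicator (fe j'))).re /
                  Real.sqrt (2 * a)) else 0) * β j'))
    -- ODD sector
    {Bo : ℕ} (hBo : 1 ≤ Bo) {ro : ℕ} (fo : Fin ro → ℝ → ℂ)
    (hfoC : ∀ j, ContDiff ℝ 3 (fo j)) (hfoo : ∀ j x, fo j (-x) = -fo j x) (hfor : ∀ j x, conj (fo j x) = fo j x)
    (hfoa : ∀ j, fo j a = 0) (hfo1 : ∀ j, deriv (fo j) (-a) = deriv (fo j) a)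
    -- DATA: far diagonal with floor and far inequality
    (dod : ℕ → ℝ) {d₀o : ℝ} (hdo₀ : 0 < d₀o) (hdo : ∀ m, Bo ≤ m → d₀o ≤ dod m)
    (hfaro : ∀ (N : ℕ) (z : ℕ → ℝ),
      ∑ k ∈ Finset.Ico Bo N, dod k * z k ^ 2 ≤ ∑ k ∈ Finset.Ico Bo N, ∑ l ∈ Finset.Ico Bo N,
        z k * ((gramCoeff a ((k : ℤ) + 1) ((l : ℤ) + 1) - gramCoeff a ((k : ℤ) + 1) (-((l : ℤ) + 1))) / 2) * z l)
    -- DATA: free map, coupling majorant, margin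
    (Λo : (Fin Bo → ℝ) → (Fin ro → ℝ) → Fin ro → ℝ) {lamo : ℝ} (hlamo : 0 ≤ lamo)
    (hΛo : ∀ (x : Fin Bo → ℝ) (β : Fin ro → ℝ), ∑ j, |Λo x β j| ≤ lamo * (∑ i, |x i| + ∑ j, |β j|))
    (Uqo : (Fin Bo → ℝ) → (Fin ro → ℝ) → ℝ)
    (hUqo : ∀ (N : ℕ) (x : Fin Bo → ℝ) (β : Fin ro → ℝ),
      ∑ m ∈ Finset.Ico Bo N,
        (∑ i : Fin Bo, ((gramCoeff a (((i : ℕ) : ℤ) + 1) ((m : ℤ) + 1) - gramCoeff a (((i : ℕ) : ℤ) + 1) (-((m : ℤ) + 1))) / 2)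
            * x i
          + ∑ j, ((weilWindowSesq a ((Icc (-a) a).indicator (fo j) - proj a Bo ((Icc (-a) a).indicator (fo j)))
              (chiOdd a (m + 1))).im / Real.sqrt 2) * β j
          - ∑ j, (2 * (Yoshida1992.fourierCoeff a ((m : ℤ) + 1) ((Icc (-a) a).indicator (fo j))).im /
              Real.sqrt (2 * a)) * Λo x β j) ^ 2 / dod m ≤ Uqo x β)
    {δo : ℝ} (hδo : 0 < δo)
    (hSo : ∀ (x : Fin Bo → ℝ) (β : Fin ro → ℝ),
      δo * (∑ i, x i ^ 2 + ∑ j, β j ^ 2) ≤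
        ((∑ i : Fin Bo, ∑ i' : Fin Bo, x i * x i' *
            ((gramCoeff a (((i : ℕ) : ℤ) + 1) (((i' : ℕ) : ℤ) + 1)
              - gramCoeff a (((i : ℕ) : ℤ) + 1) (-((((i' : ℕ) : ℤ)) + 1))) / 2))
          + 2 * (∑ i : Fin Bo, ∑ j : Fin ro, x i * β j *
            ((weilWindowSesq a ((Icc (-a) a).indicator (fo j) - proj a Bo ((Icc (-a) a).indicator (fo j)))
              (chiOdd a ((i : ℕ) + 1))).im / Real.sqrt 2))
          + (∑ j : Fin ro, ∑ j' : Fin ro, β j * β j' *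
            (weilWindowSesq a ((Icc (-a) a).indicator (fo j) - proj a Bo ((Icc (-a) a).indicator (fo j)))
              ((Icc (-a) a).indicator (fo j') - proj a Bo ((Icc (-a) a).indicator (fo j')))).re))
        - Uqo x β
        + 2 * ∑ j, Λo x β j * (β j - ∑ j', (∑' n : ℕ, if Bo ≤ n then
                (2 * (Yoshida1992.fourierCoeff a ((n : ℤ) + 1) ((Icc (-a) a).indicator (fo j))).im / Real.sqrt (2 * a)) *
                (2 * (Yoshida1992.fourierCoeff a ((n : ℤ) + 1) ((Icc (-a) a).indicator (fo j'))).im / Real.sqrt (2 * a))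
                else 0) * β j')) :
    WeilPositivityOn a :=
  weilPositivityOn_of_sector_kernels_nonneg ha (gramCoeff a) (weilWindowSesq_chi ha) (gramCoeff_neg_neg a)
    (fun K y ↦ evenKernel_nonneg_of_certificate_cinfB ha Be fe hfeC hfee hfer hfe1 de hde₀ hde hfare Λe hlame hΛe Uqe hUqe
      hδe hSe K y)
    (fun K z ↦ oddKernel_nonneg_of_certificate_cinfB ha hBo fo hfoC hfoo hfor hfoa hfo1 dod hdo₀ hdo hfaro Λo hlamo hΛo Uqo
      hUqo hδo hSo K z)


/-- **The DoorB front door with a certified prime constant** (`hPA` + `d̂_data ≤ d̂_A` replace the far inequalities). -/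
theorem weilPositivityOn_of_formatC_cinfBA (ha : 0 < a)
    {A : ℝ} (hPA : ∀ (s : Finset ℤ) (c : ℤ → ℂ),
      -(A * ∑ n ∈ s, ‖c n‖ ^ 2) ≤ ∑ n ∈ s, ∑ m ∈ s, (conj (c n) * c m).re * primeCoeff a n m)
    -- EVEN sector
    (Be : ℕ) {re : ℕ} (fe : Fin re → ℝ → ℂ)
    (hfeC : ∀ j, ContDiff ℝ 3 (fe j)) (hfee : ∀ j x, fe j (-x) = fe j x) (hfer : ∀ j x, conj (fe j x) = fe j x)
    (hfe1 : ∀ j, deriv (fe j) (-a) = deriv (fe j) a)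
    -- DATA: far diagonal with floor and far inequality
    (de : ℕ → ℝ) {d₀e : ℝ} (hde₀ : 0 < d₀e) (hde : ∀ m, Be + 1 ≤ m → d₀e ≤ de m)
    (hBe : 1 ≤ Be)
    (hdle : ∀ m : ℕ, Be + 1 ≤ m → de m ≤
      (reDigammaQuarter (freq a m) - Real.log π) / 2 - a * (1 + weilArchDensity (2 * a)) / (π ^ 2 * m ^ 2)
        - 1 / (8 * m) - a * (1 + weilArchDensity (2 * a)) / π ^ 2 * Real.sqrt (8 / ((Be + 1 - 1 : ℕ) : ℝ)) - A / 2)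
    -- DATA: free map, coupling majorant, margin
    (Λe : (Fin (Be + 1) → ℝ) → (Fin re → ℝ) → Fin re → ℝ) {lame : ℝ} (hlame : 0 ≤ lame)
    (hΛe : ∀ (x : Fin (Be + 1) → ℝ) (β : Fin re → ℝ), ∑ j, |Λe x β j| ≤ lame * (∑ i, |x i| + ∑ j, |β j|))
    (Uqe : (Fin (Be + 1) → ℝ) → (Fin re → ℝ) → ℝ)
    (hUqe : ∀ (N : ℕ) (x : Fin (Be + 1) → ℝ) (β : Fin re → ℝ),
      ∑ m ∈ Finset.Ico (Be + 1) N,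
        (∑ i : Fin (Be + 1), (if (i : ℕ) = 0 then gramCoeff a 0 m else if m = 0 then gramCoeff a i 0
            else (gramCoeff a i m + gramCoeff a i (-(m : ℤ))) / 2) * x i
          + ∑ j, ((weilWindowSesq a ((Icc (-a) a).indicator (fe j) - proj a Be ((Icc (-a) a).indicator (fe j)))
              (chiEven a m)).re / (if m = 0 then 1 else Real.sqrt 2)) * β j
          - ∑ j, ((if m = 0 then 1 else 2) * (Yoshida1992.fourierCoeff a m ((Icc (-a) a).indicator (fe j))).re /
              Real.sqrt (2 * a)) * Λe x β j) ^ 2 / de m ≤ Uqe x β)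
    {δe : ℝ} (hδe : 0 < δe)
    (hSe : ∀ (x : Fin (Be + 1) → ℝ) (β : Fin re → ℝ),
      δe * (∑ i, x i ^ 2 + ∑ j, β j ^ 2) ≤
        ((∑ i : Fin (Be + 1), ∑ i' : Fin (Be + 1), x i * x i' *
            (if (i : ℕ) = 0 then gramCoeff a 0 i' else if (i' : ℕ) = 0 then gramCoeff a i 0
              else (gramCoeff a i i' + gramCoeff a i (-(i' : ℤ))) / 2))
          + 2 * (∑ i : Fin (Be + 1), ∑ j : Fin re, x i * β j *
            ((weilWindowSesq a ((Icc (-a) a).indicator (fe j) - proj a Be ((Icc (-a) a).indicator (fe j)))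
              (chiEven a i)).re / (if (i : ℕ) = 0 then 1 else Real.sqrt 2)))
          + (∑ j : Fin re, ∑ j' : Fin re, β j * β j' *
            (weilWindowSesq a ((Icc (-a) a).indicator (fe j) - proj a Be ((Icc (-a) a).indicator (fe j)))
              ((Icc (-a) a).indicator (fe j') - proj a Be ((Icc (-a) a).indicator (fe j')))).re))
        - Uqe x β
        + 2 * ∑ j, Λe x β j * (β j - ∑ j', (∑' n : ℕ, if Be + 1 ≤ n then
                ((if n = 0 then 1 else 2) * (Yoshida1992.fourierCoeff a n ((Icc (-a) a).indicator (fe j))).re /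
                  Real.sqrt (2 * a)) *
                ((if n = 0 then 1 else 2) * (Yoshida1992.fourierCoeff a n ((Icc (-a) a).indicator (fe j'))).re /
                  Real.sqrt (2 * a)) else 0) * β j'))
    -- ODD sector
    {Bo : ℕ} (hBo : 1 ≤ Bo) {ro : ℕ} (fo : Fin ro → ℝ → ℂ)
    (hfoC : ∀ j, ContDiff ℝ 3 (fo j)) (hfoo : ∀ j x, fo j (-x) = -fo j x) (hfor : ∀ j x, conj (fo j x) = fo j x)
    (hfoa : ∀ j, fo j a = 0) (hfo1 : ∀ j, deriv (fo j) (-a) = deriv (fo j) a)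
    -- DATA: far diagonal with floor and far inequality
    (dod : ℕ → ℝ) {d₀o : ℝ} (hdo₀ : 0 < d₀o) (hdo : ∀ m, Bo ≤ m → d₀o ≤ dod m)
    (hdlo : ∀ k : ℕ, Bo ≤ k → dod k ≤
      (reDigammaQuarter (freq a ((k : ℤ) + 1)) - Real.log π) / 2 - 1 / (8 * ((k : ℝ) + 1))
        - a * (1 + weilArchDensity (2 * a)) / (π ^ 2 * ((k : ℝ) + 1) ^ 2)
        - (π / 2 - Real.arctan (Real.sqrt Bo / Real.sqrt ((k : ℝ) + 1))) / 2
        - a * (1 + weilArchDensity (2 * a)) / π ^ 2 * Real.sqrt (8 / Bo)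
        - A / 2
        - (Real.exp (a / 2) - Real.exp (-(a / 2))) ^ 2 * a / (π ^ 2 * Bo))
    -- DATA: free map, coupling majorant, margin
    (Λo : (Fin Bo → ℝ) → (Fin ro → ℝ) → Fin ro → ℝ) {lamo : ℝ} (hlamo : 0 ≤ lamo)
    (hΛo : ∀ (x : Fin Bo → ℝ) (β : Fin ro → ℝ), ∑ j, |Λo x β j| ≤ lamo * (∑ i, |x i| + ∑ j, |β j|))
    (Uqo : (Fin Bo → ℝ) → (Fin ro → ℝ) → ℝ)
    (hUqo : ∀ (N : ℕ) (x : Fin Bo → ℝ) (β : Fin ro → ℝ),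
      ∑ m ∈ Finset.Ico Bo N,
        (∑ i : Fin Bo, ((gramCoeff a (((i : ℕ) : ℤ) + 1) ((m : ℤ) + 1) - gramCoeff a (((i : ℕ) : ℤ) + 1) (-((m : ℤ) + 1))) / 2)
            * x i
          + ∑ j, ((weilWindowSesq a ((Icc (-a) a).indicator (fo j) - proj a Bo ((Icc (-a) a).indicator (fo j)))
              (chiOdd a (m + 1))).im / Real.sqrt 2) * β j
          - ∑ j, (2 * (Yoshida1992.fourierCoeff a ((m : ℤ) + 1) ((Icc (-a) a).indicator (fo j))).im /
              Real.sqrt (2 * a)) * Λo x β j) ^ 2 / dod m ≤ Uqo x β)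
    {δo : ℝ} (hδo : 0 < δo)
    (hSo : ∀ (x : Fin Bo → ℝ) (β : Fin ro → ℝ),
      δo * (∑ i, x i ^ 2 + ∑ j, β j ^ 2) ≤
        ((∑ i : Fin Bo, ∑ i' : Fin Bo, x i * x i' *
            ((gramCoeff a (((i : ℕ) : ℤ) + 1) (((i' : ℕ) : ℤ) + 1)
              - gramCoeff a (((i : ℕ) : ℤ) + 1) (-((((i' : ℕ) : ℤ)) + 1))) / 2))
          + 2 * (∑ i : Fin Bo, ∑ j : Fin ro, x i * β j *
            ((weilWindowSesq a ((Icc (-a) a).indicator (fo j) - proj a Bo ((Icc (-a) a).indicator (fo j)))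
              (chiOdd a ((i : ℕ) + 1))).im / Real.sqrt 2))
          + (∑ j : Fin ro, ∑ j' : Fin ro, β j * β j' *
            (weilWindowSesq a ((Icc (-a) a).indicator (fo j) - proj a Bo ((Icc (-a) a).indicator (fo j)))
              ((Icc (-a) a).indicator (fo j') - proj a Bo ((Icc (-a) a).indicator (fo j')))).re))
        - Uqo x β
        + 2 * ∑ j, Λo x β j * (β j - ∑ j', (∑' n : ℕ, if Bo ≤ n then
                (2 * (Yoshida1992.fourierCoeff a ((n : ℤ) + 1) ((Icc (-a) a).indicator (fo j))).im / Real.sqrt (2 * a)) *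
                (2 * (Yoshida1992.fourierCoeff a ((n : ℤ) + 1) ((Icc (-a) a).indicator (fo j'))).im / Real.sqrt (2 * a))
                else 0) * β j')) :
    WeilPositivityOn a := by
  have hfare : ∀ (N : ℕ) (y : ℕ → ℝ),
      ∑ n ∈ Finset.Ico (Be + 1) N, de n * y n ^ 2 ≤ ∑ n ∈ Finset.Ico (Be + 1) N, ∑ m ∈ Finset.Ico (Be + 1) N,
        y n * (if n = 0 then gramCoeff a 0 m else if m = 0 then gramCoeff a n 0
          else (gramCoeff a n m + gramCoeff a n (-(m : ℤ))) / 2) * y m := by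
    intro N y
    refine le_trans (Finset.sum_le_sum fun n hn ↦ ?_) (gramCoeff_even_far_ge_diag_A ha hPA (by omega : 2 ≤ Be + 1) N y)
    exact mul_le_mul_of_nonneg_right (hdle n (Finset.mem_Ico.1 hn).1) (sq_nonneg _)
  have hfaro : ∀ (N : ℕ) (z : ℕ → ℝ),
      ∑ k ∈ Finset.Ico Bo N, dod k * z k ^ 2 ≤ ∑ k ∈ Finset.Ico Bo N, ∑ l ∈ Finset.Ico Bo N,
        z k * ((gramCoeff a ((k : ℤ) + 1) ((l : ℤ) + 1) - gramCoeff a ((k : ℤ) + 1) (-((l : ℤ) + 1))) / 2) * z l := by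
    intro N z
    refine le_trans (Finset.sum_le_sum fun k hk ↦ ?_) (gramCoeff_odd_far_ge_diag_atan_A ha hPA hBo N z)
    exact mul_le_mul_of_nonneg_right (hdlo k (Finset.mem_Ico.1 hk).1) (sq_nonneg _)
  exact weilPositivityOn_of_formatC_cinfB ha Be fe hfeC hfee hfer hfe1 de hde₀ hde hfare Λe hlame hΛe Uqe hUqe hδe hSe
    hBo fo hfoC hfoo hfor hfoa hfo1 dod hdo₀ hdo hfaro Λo hlamo hΛo Uqo hUqo hδo hSo

end Summit.RiemannHypothesis.RiemannHypothesis.Theorems.WeilFormatC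

end
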